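import Summits.QuantumFields.BalabanUV.T4Continuum.Support.NE7HintUnconditionalSU2
import Summits.QuantumFields.BalabanUV.T4Continuum.Support.NE7InteriorMinimiserDocking
import HarnessLib

/-!
# NE7InteriorExistsSU2 — (H∃)ᴱ FOR SU(2), `d = 4`, `L = 2`, WITH NO DISPLAYED HYPOTHESIS: the energy-class hypothesis `hminE` of the NE7 route-1 docked ENDs
# (`NE7Route1EndDockedEnergy.goodClause_summable_of_route1_docked_energy`, `…DockedInterior…`'s (H∃) node) — «at every level SOME constrained Wilson minimiser over `sfClass 4 2 N ε` is
# `Regular 4 2 N ε g(ε) k`» — obtained by docking gen 104's unconditional (8)∃ `NE7HintUnconditionalSU2.hint_SU2_unconditional` into `NE7InteriorMinimiserDocking.hminE_of_interior_exists_d4`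
# (its one numeric line `2·10⁹·√(card n)·2⁶·ε ≤ 1` absorbed into `ε₀`)

Cell `pub-balaban`, rung (B)+1 sub-cell t4, lineage `b2b-balaban-t4-ne7-p1`, generation 104 (CRUX PROVER NE7 #1 = OWNER of BINDER row NE7).  Memo `t4/b2b-balaban-t4-ne7-p1-g104/ROAD-G104.md`.
WHAT ([folklore]; 0 def, 0 sorry).  **`interior_exists_SU2`** (statement displayed; `g(ε)` is `hminE_of_interior_exists_d4`'s explicit letter at `L = 2`).
HONEST FRAMING (page 1): composition of two landed kernel theorems; nothing of Bałaban's asserted as an axiom; no displayed hypothesis.  WHAT IT IS: node (H∃)ᴱ of the NE7 route-1 END, SU(2), `d = 4`,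
`L = 2`, finite T⁴.  WHAT IT IS NOT: the END's other sockets (the one-step socket `h`, `hsector`, the window∕decay∕moduli data, node U3's shapes, …), NOT NE7 by itself, NOT infinite volume, NOT
mass gap, NOT BetaPertH, NOT Clay (continuum YM on T⁴ ⇐ BetaPertH ∧ nine spine estimates).
-/

set_option autoImplicit false

open scoped BigOperators Matrix Matrix.Norms.L2Operator
open Finset Set

namespace Summit.QuantumFields.BalabanUV.T4Continuum.NE7InteriorExistsSU2

open Literature.MathematicalPhysics.QuantumFieldTheory.Balaban1983to89
open B7Prop1Explicit B7Prop2Explicit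
open T4AveragingDeficitWall (IsUnitaryCfg SmallField)
open T4AveragingDeficitWallBoundary (IsPeriodicCfg)
open MinimalActionSandwich (IsMinimiser)
open MinimalActionRate (Regular sfClass)
open NE7HintUnconditionalSU2 (hint_SU2_unconditional)
open NE7InteriorMinimiserDocking (hminE_of_interior_exists_d4)

noncomputable section

variable {n : Type} [Fintype n] [DecidableEq n]

/-- **(H∃)ᴱ FOR SU(2) AT `d = 4`, `L = 2` — NO DISPLAYED HYPOTHESIS**: `∃ ℓ ≥ 1, ∃ ε₀ > 0, ∀ 0 < ε ≤ ε₀, ∃ β₀ > 0, ∀ 0 < β ≤ β₀, ∀ N ≥ 1, ∃ δ_V > 0` such that for every unitary `N`-periodic `V` with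
`SmallField V δ_V` and every level `k` SOME constrained Wilson minimiser at level `k` over `V` is `Regular 4 2 N ε g(ε) k`. [folklore] -/
theorem interior_exists_SU2 [Nonempty n] (hn : Fintype.card n = 2) :
    ∃ ℓ : ℕ, 1 ≤ ℓ ∧ ∃ ε₀ : ℝ, 0 < ε₀ ∧ ∀ ε : ℝ, 0 < ε → ε ≤ ε₀ → ∃ β₀ : ℝ, 0 < β₀ ∧ ∀ β : ℝ, 0 < β → β ≤ β₀ →
    ∀ (N : ℕ) [NeZero N], 1 ≤ N →
    ∃ δV : ℝ, 0 < δV ∧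
      ∀ V ∈ {V : Site 4 → Fin 4 → (Matrix n n ℂ)ˣ | IsUnitaryCfg V ∧ IsPeriodicCfg V (N : ℤ) ∧ SmallField V δV},
      ∀ k : ℕ, ∃ U : Site 4 → Fin 4 → (Matrix n n ℂ)ˣ, IsMinimiser 4 (sfClass 4 2 N ε) 2 N k V U ∧
        Regular 4 2 N ε ((Fintype.card n : ℝ)
            * (624 * ((4 : ℕ) : ℝ) ^ 3 * ε ^ 2 * (1 + (((4 : ℕ) : ℝ) + 1) * ε) ^ 2
                + 6768 * (Fintype.card (T4AveragingDeficitWall.Plane 4) : ℝ) ^ 2 * (4 : ℕ) * Fintype.card n * ε ^ 4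
                + 16 * ((4 : ℕ) : ℝ) ^ 3 * ε ^ 2 * ((2 : ℕ) : ℝ) ^ 2)
          + 220 * (Fintype.card n : ℝ) * ((4 : ℕ) : ℝ) ^ 3 * ε ^ 3) k U := by
  obtain ⟨ℓ, hℓ1, ε₀, hε₀, H⟩ := hint_SU2_unconditional (n := n) hn
  have hc0 : 0 < 2 * 10 ^ 9 * Real.sqrt (Fintype.card n) * ((2 : ℕ) : ℝ) ^ 6 := by
    have : 0 < Real.sqrt (Fintype.card n : ℝ) := Real.sqrt_pos.2 (by exact_mod_cast Fintype.card_pos)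
    positivity
  refine ⟨ℓ, hℓ1, min ε₀ (1 / (2 * 10 ^ 9 * Real.sqrt (Fintype.card n) * ((2 : ℕ) : ℝ) ^ 6)), lt_min hε₀ (by positivity), fun ε hε hεle => ?_⟩
  obtain ⟨β₀, hβ₀, H2⟩ := H ε hε (hεle.trans (min_le_left _ _))
  refine ⟨β₀, hβ₀, fun β hβ hβle N _ hN => ?_⟩
  obtain ⟨δV, hδV, hint⟩ := H2 β hβ hβle N hN
  have hline : 2 * 10 ^ 9 * Real.sqrt (Fintype.card n) * ((2 : ℕ) : ℝ) ^ 6 * ε ≤ 1 := by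
    have h1 : ε ≤ 1 / (2 * 10 ^ 9 * Real.sqrt (Fintype.card n) * ((2 : ℕ) : ℝ) ^ 6) := hεle.trans (min_le_right _ _)
    rw [le_div_iff₀ hc0] at h1; linarith only [h1]
  exact ⟨δV, hδV, hminE_of_interior_exists_d4 (L := 2) (le_refl 2) hN hε.le hline hint⟩

end

end Summit.QuantumFields.BalabanUV.T4Continuum.NE7InteriorExistsSU2
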